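import Mathlib
import HarnessLib
import Summits.HubbardSuperconductivity.HubbardSuperconductivity.Theorems.KLProgrammeKLRegimeEnginePairTransferBaseSecondOrder

/-!
# Route `KLProgramme` — ENGINE item stmt-HubbardSuperconductivity-20437 `KLRegimeEngineV17F2`, class #5 BASE, located item «SCALE0-MEMBER-DIFF» (pen (R494)(C)(iii)),
# PART 1c: THE CLOSED `U³` FORM — **`klso_memberDiff_sub_second_le_of_frameOK`**, **`klso_memberDiff_sub_second_le_cube`**
# (cell gate-hubbard-kl, seat hubbard-kl-k3c1-p1 g23; constants as in `klmg_memberAmplitude_sub_le_of_frameOK/_sq`)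

WHY.  `klso_memberDiff_sub_second_le_of_gridStep` (`…PairTransferBaseSecondOrder`) at the tree's scale-0 constants: `κ₀ = ρ = √(2(7+6047))`
(`isGramBoundedR_scaleZero_of_frameOK_sharp`), member Gram `√6047` (`isGramBoundedR_gridSub_softSubCov_zero`), `D`-line Gram `√(Λ₀·klIdxMass 0 j′)`
(`klmg_isGramBoundedR_gridSub_dLine`), decay `α = (N/β)·klScaleZeroA0` (`rowSum/colSum_scaleZero_le_A0`), degree-2 size from `klKappaFrameC R·|U|`,
`(N/β)·‖Ṽ‖_h ≤ klScaleZeroCV R·U`, `θ ≤ klScaleZeroThetaC R·U ≤ 1/4`: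
**`klso_memberDiff_sub_second_le_cube`** — `‖(𝒜₀[S_{0,j}] − 𝒜₀[S_{0,j′}]) − (E₂[s_{0,j}] − E₂[s_{0,j′}])‖ ≤ (56/(5·6047))·klIdxMass 0 j′·(klTransferC R·klScaleZeroThetaC R·U³)`
= the old member-difference constant `(4/6047)·klTransferC R·U²` (`klmg_memberAmplitude_sub_le_sq`) times `(14/5)·klScaleZeroThetaC R·U`: ONE MORE POWER OF `U`.
So once the explicit second-order term `E₂` is bounded by `X₂·klIdxMass 0 j′·U²` (scope (L4), the one-loop bubble with a `D`-line — NOT in this file), the BASE scalar row of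
«95v2» re-keys to `(X₂·U² + Y₃(R)·U³)·ms + 4·(mA U)²·ms ≤ θ·r·(Klam U)²·ms` with `Y₃(R) = (56/(5·6047))·klTransferC R·klScaleZeroThetaC R` — dischargeable inside the cap.
Composition of landed theorems + real arithmetic; nothing about the model's sizes is asserted; nothing asserts (X), any stub, K3 or superconductivity.  0 kit · 0 lit.
References: BGM 2006 (2.13)–(2.14), (2.77)–(2.80) [cite: BenfattoGiulianiMastropietro2006].
-/

noncomputable section

namespace Summit.HubbardSuperconductivity.HubbardSuperconductivity.Theorems.KLRegimeSplit

set_option linter.dupNamespace false -- summit = problem name (single-conjunct summit), D-0017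

open Real Finset Matrix Set Literature.MathematicalPhysics.QuantumLattice Literature.Probability.LatticeModels GrassmannAlgebra
open Summit.HubbardSuperconductivity.HubbardSuperconductivity.Theorems.KLProgrammeLegKernels
open Summit.HubbardSuperconductivity.HubbardSuperconductivity.Theorems.DispersionFlow
open Summit.HubbardSuperconductivity.HubbardSuperconductivity.Theorems.KLRegimeWick
open Summit.HubbardSuperconductivity.HubbardSuperconductivity.Theorems.EngineV8
open Summit.HubbardSuperconductivity.HubbardSuperconductivity.Theorems.ScaleZeroDecay

section Closed

variable {L M : ℕ} [NeZero L]

/-! ## §4 At the tree's scale-`0` constants, and the closed `U³` form -/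

/-- **`klso_memberDiff_sub_second_le_of_frameOK`** — the same at `κ₀ = ρ = √(2(7+6047))`, `γ = √6047` (member `s_{0,j′}`), `κD = √(Λ₀·klIdxMass 0 j′)` (`D`-line), for
`θ ≤ 1/4`, `j′ ≤ j`, modulo the decay `α` and the degree-2 size `N₁`. -/
theorem klso_memberDiff_sub_second_le_of_frameOK [NeZero M] {R : RenConsts} {U : ℝ} {Nsc : ℕ} {μ : ℝ} {K : TrigPolyC4v}
    (hK : FrameOK R U Nsc μ K) {β : ℝ} (hβ : klBetaMin ≤ β) (hβL : β ≤ L)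
    {α : ℝ} (hα : 0 < α)
    (hrow : ∀ X, ∑ Y, ‖((hubbardGridSub L M β (2 * (2 * M))).transpose * hubbardCovAboveCT L M β μ 0 K klE0 *
      hubbardGridSub L M β (2 * (2 * M))) X Y‖ ≤ α)
    (hcol : ∀ Y, ∑ X, ‖((hubbardGridSub L M β (2 * (2 * M))).transpose * hubbardCovAboveCT L M β μ 0 K klE0 *
      hubbardGridSub L M β (2 * (2 * M))) X Y‖ ≤ α)
    {N₁ : ℝ} (hN₁ : 0 ≤ N₁)
    (hct : ∀ (j : Fin 2) (w : GridLeg (GridPoint L (2 * (2 * M)))),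
      ∑ Y ∈ univ.filter (fun Y : Fin 2 → GridLeg (GridPoint L (2 * (2 * M))) => Y j = w),
        ‖kernel ℂ (hubbardGridCounterQuadratic L (2 * (2 * M)) β K) 2 Y‖ ≤ N₁)
    (hθ : Real.exp 1 * α * normV (GridLeg (GridPoint L (2 * (2 * M)))) (Real.sqrt (2 * (7 + 6047))) (Real.sqrt (2 * (7 + 6047)))
      (fun m' : ℕ => if m' = 1 then N₁ else if m' = 2 then |U| * |β| / (2 * (2 * M) : ℕ) else 0) / Real.sqrt (2 * (7 + 6047)) ^ 2 ≤ 1 / 4)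
    (T₂ : GrassmannAlgebra ℂ (GridLeg (GridPoint L (2 * (2 * M)))))
    (hT₂ : T₂ = -((((2 : ℕ).factorial : ℕ) : ℂ)⁻¹ •
      ((cumulantOf (fun k => evenGaussConv ℂ ((hubbardGridSub L M β (2 * (2 * M))).transpose * hubbardCovAboveCT L M β μ 0 K klE0 * hubbardGridSub L M β (2 * (2 * M)))
        ((⟨-(hubbardGridInteraction L (2 * (2 * M)) β U + hubbardGridCounterQuadratic L (2 * (2 * M)) β K),
          neg_mem (add_mem (hubbardGridInteraction_mem_evenPart β U) (hubbardGridCounterQuadratic_mem_evenPart β K))⟩ :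
            evenPart ℂ (GridLeg (GridPoint L (2 * (2 * M))))) ^ k)) 2 : evenPart ℂ (GridLeg (GridPoint L (2 * (2 * M))))) :
              GrassmannAlgebra ℂ (GridLeg (GridPoint L (2 * (2 * M)))))))
    {j j' : ℕ} (hj : j' ≤ j) (Qm k k' : TorusSite 2 L) :
    ‖(klCovSmearedPairAmplitude L M β U μ K 0 (softCovOf L M β μ K (softSymbolCompl L M β μ K 0 j)) Qm k k' -
          klCovSmearedPairAmplitude L M β U μ K 0 (softCovOf L M β μ K (softSymbolCompl L M β μ K 0 j')) Qm k k') -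
        (vertexFn L M β (ExteriorAlgebra.map (Matrix.toLin' (hubbardGridSub L M β (2 * (2 * M))))
            (gaussConv ℂ ((hubbardGridSub L M β (2 * (2 * M))).transpose * softCovOf L M β μ K (softSymbolCompl L M β μ K 0 j) * hubbardGridSub L M β (2 * (2 * M))) T₂)) 4
              (pairLegs L M Qm k k') -
          vertexFn L M β (ExteriorAlgebra.map (Matrix.toLin' (hubbardGridSub L M β (2 * (2 * M))))
            (gaussConv ℂ ((hubbardGridSub L M β (2 * (2 * M))).transpose * softCovOf L M β μ K (softSymbolCompl L M β μ K 0 j') * hubbardGridSub L M β (2 * (2 * M))) T₂)) 4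
              (pairLegs L M Qm k k'))‖ ≤
      96 * ((2 * (2 * M) : ℕ) : ℝ) / β *
        (1792 * (Real.sqrt (klScale klE0 0 * klIdxMass 0 j')) ^ 2 * (2 * (Real.sqrt (2 * (7 + 6047)))⁻¹) ^ 6 *
          (Real.exp 1 * normV (GridLeg (GridPoint L (2 * (2 * M)))) (Real.sqrt (2 * (7 + 6047))) (Real.sqrt (2 * (7 + 6047)))
              (fun m' : ℕ => if m' = 1 then N₁ else if m' = 2 then |U| * |β| / (2 * (2 * M) : ℕ) else 0) /
            (1 - Real.exp 1 * α * normV (GridLeg (GridPoint L (2 * (2 * M)))) (Real.sqrt (2 * (7 + 6047))) (Real.sqrt (2 * (7 + 6047)))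
              (fun m' : ℕ => if m' = 1 then N₁ else if m' = 2 then |U| * |β| / (2 * (2 * M) : ℕ) else 0) / Real.sqrt (2 * (7 + 6047)) ^ 2) *
            (Real.exp 1 * α * normV (GridLeg (GridPoint L (2 * (2 * M)))) (Real.sqrt (2 * (7 + 6047))) (Real.sqrt (2 * (7 + 6047)))
              (fun m' : ℕ => if m' = 1 then N₁ else if m' = 2 then |U| * |β| / (2 * (2 * M) : ℕ) else 0) / Real.sqrt (2 * (7 + 6047)) ^ 2) ^ 2)) := by
  have hβpos : 0 < β := pos_of_klBetaMin_le hβ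
  have hκ : 0 < Real.sqrt (2 * (7 + 6047)) := Real.sqrt_pos.2 (by norm_num)
  set θ : ℝ := Real.exp 1 * α * normV (GridLeg (GridPoint L (2 * (2 * M)))) (Real.sqrt (2 * (7 + 6047))) (Real.sqrt (2 * (7 + 6047)))
      (fun m' : ℕ => if m' = 1 then N₁ else if m' = 2 then |U| * |β| / (2 * (2 * M) : ℕ) else 0) / Real.sqrt (2 * (7 + 6047)) ^ 2 with hθdef
  have hθ0 : 0 ≤ θ := by
    rw [hθdef]
    exact div_nonneg (mul_nonneg (by positivity) (normV_nonneg hκ.le hκ.le (klsv_profile_nonneg β U _ hN₁))) (by positivity)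
  have hθ1 : θ < 1 := by linarith
  have hy : 4 * ((Real.sqrt 6047) ^ 2 * θ * (Real.sqrt (2 * (7 + 6047)))⁻¹ ^ 2) ≤ 1 / 2 := by
    rw [Real.sq_sqrt (by norm_num), inv_pow, Real.sq_sqrt (by norm_num)]
    nlinarith
  have hg : 4 * ((Real.sqrt 6047) ^ 2 * (Real.sqrt (2 * (7 + 6047)))⁻¹ ^ 2) ≤ 2 := by
    rw [Real.sq_sqrt (by norm_num), inv_pow, Real.sq_sqrt (by norm_num)]
    norm_num
  have hms : klScale klE0 0 * klIdxMass 0 j' ≤ 15367 / 32 := by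
    have h1 := klIdxMass_le 0 j'
    have h0 := klIdxMass_nonneg 0 j'
    rw [show klScale klE0 0 = 1 / 32 by simp [klScale, klE0]]
    nlinarith
  have hms0 : 0 ≤ klScale klE0 0 * klIdxMass 0 j' := mul_nonneg (klth_klScale_pos 0).le (klIdxMass_nonneg 0 j')
  have hyD : 4 * ((Real.sqrt (klScale klE0 0 * klIdxMass 0 j')) ^ 2 * θ * (2 * (Real.sqrt (2 * (7 + 6047)))⁻¹) ^ 2) ≤ 1 / 2 := by
    rw [Real.sq_sqrt hms0, mul_pow, inv_pow, Real.sq_sqrt (by norm_num)]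
    nlinarith [mul_nonneg hms0 hθ0]
  have hu : 4 * ((Real.sqrt (klScale klE0 0 * klIdxMass 0 j')) ^ 2 * (2 * (Real.sqrt (2 * (7 + 6047)))⁻¹) ^ 2) ≤ 1 := by
    rw [Real.sq_sqrt hms0, mul_pow, inv_pow, Real.sq_sqrt (by norm_num)]
    nlinarith
  exact klso_memberDiff_sub_second_le_of_gridStep hβpos U μ K hκ (isGramBoundedR_scaleZero_of_frameOK_sharp hK hβ hβL) hα hrow hcol hκ hN₁ hct hθ1 _ _
    (Real.sqrt_nonneg _) (isGramBoundedR_gridSub_softSubCov_zero hK hβ hβL (isSoftSubCov_softCovOf (isSoftSymbol_compl β μ K (Nat.zero_le j'))))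
    (Real.sqrt_nonneg _) (klmg_isGramBoundedR_gridSub_dLine L M hK hβ hβL (Nat.zero_le j') hj _) hy hyD hg hu T₂ hT₂ Qm k k'

/-- **`klso_memberDiff_sub_second_le_cube`** — CLOSED: for `R.WF`, `0 < U ≤ 1`, `FrameOK R U N μ K`, `klBetaMin ≤ β ≤ L`, `β³ ≤ M`, `klScaleZeroThetaC R·U ≤ 1/4`, `j′ ≤ j`,
every `Q, k, k′`: `‖(𝒜₀[S_{0,j}] − 𝒜₀[S_{0,j′}]) − (E₂[s_{0,j}] − E₂[s_{0,j′}])‖ ≤ (56/(5·6047))·klIdxMass 0 j′·(klTransferC R·klScaleZeroThetaC R·U³)` — the old constant times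
`(14/5)·klScaleZeroThetaC R·U`, i.e. ONE MORE POWER OF `U`. -/
theorem klso_memberDiff_sub_second_le_cube [NeZero M] {R : RenConsts} (hR : R.WF) {U : ℝ} (hU : 0 < U) (hU1 : U ≤ 1)
    {Nsc : ℕ} {μ : ℝ} {K : TrigPolyC4v} (hK : FrameOK R U Nsc μ K) {β : ℝ} (hβ : klBetaMin ≤ β) (hβL : β ≤ L)
    (hβM : β ^ 3 ≤ (M : ℝ)) (hθ : klScaleZeroThetaC R * U ≤ 1 / 4)
    (T₂ : GrassmannAlgebra ℂ (GridLeg (GridPoint L (2 * (2 * M)))))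
    (hT₂ : T₂ = -((((2 : ℕ).factorial : ℕ) : ℂ)⁻¹ •
      ((cumulantOf (fun k => evenGaussConv ℂ ((hubbardGridSub L M β (2 * (2 * M))).transpose * hubbardCovAboveCT L M β μ 0 K klE0 * hubbardGridSub L M β (2 * (2 * M)))
        ((⟨-(hubbardGridInteraction L (2 * (2 * M)) β U + hubbardGridCounterQuadratic L (2 * (2 * M)) β K),
          neg_mem (add_mem (hubbardGridInteraction_mem_evenPart β U) (hubbardGridCounterQuadratic_mem_evenPart β K))⟩ :
            evenPart ℂ (GridLeg (GridPoint L (2 * (2 * M))))) ^ k)) 2 : evenPart ℂ (GridLeg (GridPoint L (2 * (2 * M))))) :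
              GrassmannAlgebra ℂ (GridLeg (GridPoint L (2 * (2 * M)))))))
    {j j' : ℕ} (hj : j' ≤ j) (Qm k k' : TorusSite 2 L) :
    ‖(klCovSmearedPairAmplitude L M β U μ K 0 (softCovOf L M β μ K (softSymbolCompl L M β μ K 0 j)) Qm k k' -
          klCovSmearedPairAmplitude L M β U μ K 0 (softCovOf L M β μ K (softSymbolCompl L M β μ K 0 j')) Qm k k') -
        (vertexFn L M β (ExteriorAlgebra.map (Matrix.toLin' (hubbardGridSub L M β (2 * (2 * M))))
            (gaussConv ℂ ((hubbardGridSub L M β (2 * (2 * M))).transpose * softCovOf L M β μ K (softSymbolCompl L M β μ K 0 j) * hubbardGridSub L M β (2 * (2 * M))) T₂)) 4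
              (pairLegs L M Qm k k') -
          vertexFn L M β (ExteriorAlgebra.map (Matrix.toLin' (hubbardGridSub L M β (2 * (2 * M))))
            (gaussConv ℂ ((hubbardGridSub L M β (2 * (2 * M))).transpose * softCovOf L M β μ K (softSymbolCompl L M β μ K 0 j') * hubbardGridSub L M β (2 * (2 * M))) T₂)) 4
              (pairLegs L M Qm k k'))‖ ≤
      56 / (5 * 6047) * klIdxMass 0 j' * (klTransferC R * klScaleZeroThetaC R * U ^ 3) := by
  -- notation and signs (as in `klmg_memberAmplitude_sub_le_sq`)
  haveI : NeZero (2 * (2 * M)) := ⟨by have := NeZero.ne M; omega⟩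
  have hβ0 : 0 < β := pos_of_klBetaMin_le hβ
  have hN0 : 0 < (((2 * (2 * M)) : ℕ) : ℝ) := by exact_mod_cast Nat.pos_of_ne_zero (NeZero.ne (2 * (2 * M)))
  have hUabs : |U| = U := abs_of_pos hU
  have hU1' : |U| ≤ 1 := by rwa [hUabs]
  have hG0 : 0 ≤ R.Gfr 0 := hR.2.2 0
  set κ₀ : ℝ := Real.sqrt (2 * (7 + 6047)) with hκ₀
  have hκ : 0 < κ₀ := Real.sqrt_pos.2 (by norm_num)
  have hA0 := klScaleZeroA0_pos
  have hCV := klScaleZeroCV_pos hG0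
  have hTC := klScaleZeroThetaC_pos hG0
  -- the decay constant
  set α : ℝ := (((2 * (2 * M)) : ℕ) : ℝ) / β * klScaleZeroA0 with hα
  have hαpos : 0 < α := by positivity
  have hrow := fun X => rowSum_scaleZero_le_A0 (L := L) (μ := μ) hK hβ hβM X
  have hcol := fun Y => colSum_scaleZero_le_A0 (L := L) (μ := μ) hK hβ hβM Y
  -- the degree-2 size
  set kK : ℝ := klKappaFrameC R * |U| with hkK
  have hkKframe : ∑ z : TorusSite 2 L, ‖framePosKernel L K z‖ ≤ kK :=
    sum_norm_framePosKernel_le_linear_of_frameOK hR hU.ne' hU1' hK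
  set N₁ : ℝ := |β| / ((2 * (2 * M) : ℕ) : ℝ) * kK with hN₁
  have hkK0 : 0 ≤ kK := by rw [hkK]; exact mul_nonneg (klKappaFrameC_pos hG0).le (abs_nonneg U)
  have hN₁0 : 0 ≤ N₁ := by positivity
  have hct : ∀ (j : Fin 2) (w : GridLeg (GridPoint L (2 * (2 * M)))),
      ∑ Y ∈ univ.filter (fun Y : Fin 2 → GridLeg (GridPoint L (2 * (2 * M))) => Y j = w),
        ‖kernel ℂ (hubbardGridCounterQuadratic L (2 * (2 * M)) β K) 2 Y‖ ≤ N₁ := fun j w =>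
    (sum_norm_kernel_hubbardGridCounterQuadratic_le_l1 β K j w).trans (mul_le_mul_of_nonneg_left hkKframe (by positivity))
  -- the field-weighted norm and the smallness
  set V : ℝ := normV (GridLeg (GridPoint L (2 * (2 * M)))) κ₀ κ₀
    (fun m' : ℕ => if m' = 1 then N₁ else if m' = 2 then |U| * |β| / ((2 * (2 * M)) : ℕ) else 0) with hV
  have hVeq : V = (Real.exp 2 * (κ₀ + κ₀)) ^ 2 * (|β| / ((2 * (2 * M) : ℕ) : ℝ) * kK) + (Real.exp 2 * (κ₀ + κ₀)) ^ 4 * (|U| * |β| / ((2 * (2 * M) : ℕ) : ℝ)) := by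
    rw [hV, hN₁]
    exact normV_scaleZeroPinnedL1_eq four_le_card_gridLeg κ₀ κ₀ β U kK (2 * (2 * M))
  have hNV : (((2 * (2 * M)) : ℕ) : ℝ) / β * V ≤ klScaleZeroCV R * U := by
    rw [hVeq, abs_of_pos hβ0, hkK, hUabs, klScaleZeroCV, ← hκ₀, show κ₀ + κ₀ = 2 * κ₀ by ring]
    have h2 : 0 ≤ (Real.exp 2 * (2 * κ₀)) ^ 2 := sq_nonneg _
    have h4 : 0 ≤ (Real.exp 2 * (2 * κ₀)) ^ 4 := by positivity
    have hKC : 0 ≤ klKappaFrameC R := (klKappaFrameC_pos hG0).le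
    have hM0 : (M : ℝ) ≠ 0 := by exact_mod_cast NeZero.ne M
    refine le_of_eq ?_
    push_cast
    field_simp
  have hV0 : 0 ≤ V := by
    rw [hV]; exact normV_nonneg hκ.le hκ.le (klsv_profile_nonneg β U (2 * (2 * M)) hN₁0)
  set θ : ℝ := Real.exp 1 * α * V / κ₀ ^ 2 with hθdef
  have hθle : θ ≤ klScaleZeroThetaC R * U := by
    have h1 : θ = Real.exp 1 * klScaleZeroA0 * ((((2 * (2 * M)) : ℕ) : ℝ) / β * V) / κ₀ ^ 2 := by rw [hθdef, hα]; ring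
    rw [h1, klScaleZeroThetaC, ← hκ₀]
    have : Real.exp 1 * klScaleZeroA0 * ((((2 * (2 * M)) : ℕ) : ℝ) / β * V) ≤ Real.exp 1 * klScaleZeroA0 * (klScaleZeroCV R * U) :=
      mul_le_mul_of_nonneg_left hNV (by positivity)
    calc Real.exp 1 * klScaleZeroA0 * ((((2 * (2 * M)) : ℕ) : ℝ) / β * V) / κ₀ ^ 2
        ≤ Real.exp 1 * klScaleZeroA0 * (klScaleZeroCV R * U) / κ₀ ^ 2 := div_le_div_of_nonneg_right this (by positivity)
      _ = _ := by ring
  have hθq : θ ≤ 1 / 4 := hθle.trans hθ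
  have hθ0 : 0 ≤ θ := by positivity
  -- the mass
  set ms : ℝ := klScale klE0 0 * klIdxMass 0 j' with hms
  have hms0 : 0 ≤ ms := mul_nonneg (klth_klScale_pos 0).le (klIdxMass_nonneg 0 j')
  have hmsE : ms = 1 / 32 * klIdxMass 0 j' := by rw [hms, show klScale klE0 0 = 1 / 32 by simp [klScale, klE0]]
  -- the parametric bound
  have hmain := klso_memberDiff_sub_second_le_of_frameOK (L := L) (M := M) hK hβ hβL hαpos hrow hcol hN₁0 hct (by rw [← hκ₀]; exact hθq) T₂ hT₂ hj Qm k k'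
  rw [← hκ₀, Real.sq_sqrt hms0] at hmain
  refine hmain.trans ?_
  change 96 * (((2 * (2 * M)) : ℕ) : ℝ) / β * (1792 * ms * (2 * κ₀⁻¹) ^ 6 * (Real.exp 1 * V / (1 - θ) * θ ^ 2)) ≤
    56 / (5 * 6047) * klIdxMass 0 j' * (klTransferC R * klScaleZeroThetaC R * U ^ 3)
  -- `V/(1−θ)·θ² ≤ (β/N)·CV·U·(4/3)·(ThetaC·U)²`
  have hfrac : θ ^ 2 / (1 - θ) ≤ 4 / 3 * (klScaleZeroThetaC R * U) ^ 2 := by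
    rw [div_le_iff₀ (by linarith)]
    have hsq : θ ^ 2 ≤ (klScaleZeroThetaC R * U) ^ 2 := pow_le_pow_left₀ hθ0 hθle 2
    nlinarith [mul_nonneg hθ0 (by positivity : (0:ℝ) ≤ (klScaleZeroThetaC R * U) ^ 2), sq_nonneg (klScaleZeroThetaC R * U)]
  have hκ6 : 0 ≤ κ₀⁻¹ ^ 6 := by positivity
  have hms' : 0 ≤ klIdxMass 0 j' := klIdxMass_nonneg 0 j'
  calc 96 * (((2 * (2 * M)) : ℕ) : ℝ) / β * (1792 * ms * (2 * κ₀⁻¹) ^ 6 * (Real.exp 1 * V / (1 - θ) * θ ^ 2))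
      = 64 * ms * (96 * 1792 * κ₀⁻¹ ^ 6 * (Real.exp 1 * ((((2 * (2 * M)) : ℕ) : ℝ) / β * V)) * (θ ^ 2 / (1 - θ))) := by ring
    _ ≤ 64 * ms * (96 * 1792 * κ₀⁻¹ ^ 6 * (Real.exp 1 * (klScaleZeroCV R * U)) * (4 / 3 * (klScaleZeroThetaC R * U) ^ 2)) := by
        refine mul_le_mul_of_nonneg_left ?_ (by positivity)
        exact mul_le_mul (mul_le_mul_of_nonneg_left (mul_le_mul_of_nonneg_left hNV (by positivity)) (by positivity)) hfrac
          (div_nonneg (sq_nonneg θ) (by linarith)) (by positivity)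
    _ = 56 / (5 * 6047) * klIdxMass 0 j' * (klTransferC R * klScaleZeroThetaC R * U ^ 3) := by
        rw [klTransferC, klScaleZeroThetaC, ← hκ₀, hmsE]
        field_simp
        ring

end Closed

end Summit.HubbardSuperconductivity.HubbardSuperconductivity.Theorems.KLRegimeSplit

end
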